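import Literature.NumberTheory.ModularForms.KernelBounds24Plus
import Literature.NumberTheory.ModularForms.KernelBoundsMinus8
import Literature.NumberTheory.ModularForms.LogLambdaThirdOrder
import HarnessLib

/-!
# The bound (4.14) for `𝒦₋^{(24)}`: `𝒦₋^{(24)}(τ, z) = O(|τ| e^{−4π Im τ})` as `Im τ → ∞`

Cohn–Kumar–Miller–Radchenko–Viazovska, arXiv:1902.05438, §4.4 (4.14): "for fixed `z` and `τ → ∞`,
… `𝒦^{(24)}(τ,z), 𝒦±^{(24)}(τ,z) = O(|τ e^{4πiτ}|)`."

PROVED here for `𝒦₋^{(24)}` and fixed `z` (`kernelMinus24_isBigO`). Off the poles,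
`𝒦₋^{(24)}·Δ(z)/c = ψ̃₂(z)·𝒜 + f₋₂(z)ψ̃₄(z)·𝓑 + f₂(z)ψ̃₀(z)·𝒟` with (`J = j(τ) − j(z)`, `𝔠 = 1728`)
`𝒜 = −2𝔠Δ + ψ₂E₁₀(jJ⁻¹ + 2) + ψ₄E₈(𝔠J⁻¹ − 2 − jJ⁻¹)`, `𝓑 = (ψ₄E₈ − ψ₂E₁₀)J⁻¹`, `𝒟 = −2𝔠ΔJ⁻¹`.
With `Λ = πiτ + log 16`, `q = e^{2πiτ}`, `b = q^{1/2}`, the asymptotics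
`ψ₂ − ψ₄ = (336Λ + 1152)q + O(|τ|q²)` (`psi2_sub_psi4_second_order`: here the orders `b²` and
`b³` of `(ξ₂ − ξ₄)𝓛 + (ξ₂|S − ξ₄|S)𝓛_S` are computed from `U, W` to order `b⁴`, `V` to `b⁵`,
`𝓛` to `b²`, `𝓛_S` to `b³`; the `b³`-terms `∓2688b³` cancel), `ψ₄ = 2Λ + O(|τ|q)`,
`E₁₀ − E₈ = −744q + O(q²)`, `J⁻¹, Δ = q + O(q²)` give
`D₁ = ψ₂E₁₀ − ψ₄E₈ = (1152 − 1152Λ)q + O(|τ|q²)`, `D₂ = ψ₄E₈J⁻¹ − 2Δ = (2Λ − 2)q + O(|τ|q²)`, and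
`𝒜 = 3D₁ + j(z)J⁻¹D₁ + 𝔠D₂` has vanishing `q`-coefficient `3(1152 − 1152Λ) + 1728(2Λ − 2) = 0`.

## References

* H. Cohn, A. Kumar, S. D. Miller, D. Radchenko, M. Viazovska, Ann. of Math. 196 (2022),
  arXiv:1902.05438, Theorem 4.1 (4), §4.4 (4.14). [CohnEtAl2019]
-/

noncomputable section

open Complex hiding I
open Filter Topology Asymptotics ModularForm SlashInvariantForm EisensteinSeries
open UpperHalfPlane hiding I
open Complex (I)
open scoped Real MatrixGroups ModularForm Manifold

namespace Literature.NumberTheory.ModularForms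

open Literature.NumberTheory.EllipticCurves.ModularForms (kleinJ E₄_cube_eq_kleinJ_mul)

/-! ## Conversions between the comparison functions -/

/-- `e^{−4πy} = (e^{−πy})⁴ = (e^{−2πy})²`. [folklore] -/
theorem expDecayHalf_pow_four (τ : ℍ) : expDecayHalf τ ^ 4 = expDecay τ ^ 2 := by
  rw [expDecay_eq_sq]; ring

/-- `expDecayHalf_sq'` (auxiliary). [folklore] -/
theorem expDecayHalf_sq' (τ : ℍ) : expDecayHalf τ ^ 2 = expDecay τ := (expDecay_eq_sq τ).symm

/-! ## `ξ`-combinations to the needed orders -/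

/-- **`ξ₂ − ξ₄ − 336q = O(e^{−4πy})`** (`U + W − U² − W² + 2V²` from the fourth-order expansions of
`U, W` and `V = 16b + 64b³ + O(b⁵)`; the polynomial remainder is `1920b⁴ + 6144b⁶`). [cite: CohnEtAl2019, §4.4 (4.14)] -/
theorem xi2_sub_xi4_fourth_order :
    (fun τ => xi2 τ - xi4 τ - 336 * qhalf τ ^ 2) =O[atImInfty] fun τ => expDecayHalf τ ^ 4 := by
  obtain ⟨hU1, hV1, hW1⟩ := thetaUVW_isBigO_one
  have hA := thetaU_fourth_order
  have hB := thetaW_fourth_order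
  have hV := thetaV_fourth_order.trans (expDecayHalf_pow_isBigO_pow (m := 5) (n := 4) (by norm_num))
  have hq := qhalf_isBigO
  have hq1 := qhalf_isBigO_one
  -- polynomial truncations
  set PU : ℍ → ℂ := fun τ => 1 + 8 * qhalf τ + 24 * qhalf τ ^ 2 + 32 * qhalf τ ^ 3 with hPU
  set PW : ℍ → ℂ := fun τ => 1 - 8 * qhalf τ + 24 * qhalf τ ^ 2 - 32 * qhalf τ ^ 3 with hPW
  set PV : ℍ → ℂ := fun τ => 16 * qhalf τ + 64 * qhalf τ ^ 3 with hPV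
  have hform : ∀ τ : ℍ, xi2 τ - xi4 τ - 336 * qhalf τ ^ 2 =
      (thetaU τ - PU τ) * (1 - thetaU τ - PU τ) + (thetaW τ - PW τ) * (1 - thetaW τ - PW τ)
      + 2 * ((thetaV τ - PV τ) * (thetaV τ + PV τ))
      + qhalf τ ^ 4 * (1920 + 6144 * qhalf τ ^ 2) := by
    intro τ
    simp only [xi2, xi4, hPU, hPW, hPV, Pi.add_apply, Pi.sub_apply, Pi.mul_apply, Pi.smul_apply, smul_eq_mul]
    ring
  have hPb : ∀ (c₀ c₁ c₂ c₃ : ℂ), (fun τ => c₀ + c₁ * qhalf τ + c₂ * qhalf τ ^ 2 + c₃ * qhalf τ ^ 3) =O[atImInfty]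
      fun _ : ℍ => (1 : ℝ) := by
    intro c₀ c₁ c₂ c₃
    have p2 : (fun τ => qhalf τ ^ 2) =O[atImInfty] fun _ : ℍ => (1 : ℝ) := by simpa [sq] using isBigO_mul_of_isBigO_one hq1 hq1
    have p3 : (fun τ => qhalf τ ^ 3) =O[atImInfty] fun _ : ℍ => (1 : ℝ) := by
      simpa [pow_succ] using isBigO_mul_of_isBigO_one (isBigO_mul_of_isBigO_one hq1 hq1) hq1
    by_cases h0 : c₀ = 0
    · subst h0
      have := ((hq1.const_mul_left c₁).add (p2.const_mul_left c₂)).add (p3.const_mul_left c₃)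
      exact this.congr_left fun τ => by ring
    · exact (((isBigO_const_const c₀ one_ne_zero _).add (hq1.const_mul_left c₁)).add (p2.const_mul_left c₂)).add
        (p3.const_mul_left c₃)
  have hPU1 : PU =O[atImInfty] fun _ : ℍ => (1 : ℝ) := hPb 1 8 24 32
  have hPW1 : PW =O[atImInfty] fun _ : ℍ => (1 : ℝ) := (hPb 1 (-8) 24 (-32)).congr_left fun τ => by simp only [hPW]; ring
  have hPV1 : PV =O[atImInfty] fun _ : ℍ => (1 : ℝ) := (hPb 0 16 0 64).congr_left fun τ => by simp only [hPV]; ring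
  have t1 : (fun τ => (thetaU τ - PU τ) * (1 - thetaU τ - PU τ)) =O[atImInfty] fun τ => expDecayHalf τ ^ 4 := by
    have hb : (fun τ => 1 - thetaU τ - PU τ) =O[atImInfty] fun _ : ℍ => (1 : ℝ) :=
      ((isBigO_const_const (1 : ℂ) one_ne_zero _).sub hU1).sub hPU1
    have hA' : (fun τ => thetaU τ - PU τ) =O[atImInfty] fun τ => expDecayHalf τ ^ 4 :=
      hA.congr_left fun τ => by simp only [hPU]; ring
    simpa using hA'.mul hb
  have t2 : (fun τ => (thetaW τ - PW τ) * (1 - thetaW τ - PW τ)) =O[atImInfty] fun τ => expDecayHalf τ ^ 4 := by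
    have hb : (fun τ => 1 - thetaW τ - PW τ) =O[atImInfty] fun _ : ℍ => (1 : ℝ) :=
      ((isBigO_const_const (1 : ℂ) one_ne_zero _).sub hW1).sub hPW1
    have hB' : (fun τ => thetaW τ - PW τ) =O[atImInfty] fun τ => expDecayHalf τ ^ 4 :=
      hB.congr_left fun τ => by simp only [hPW]; ring
    simpa using hB'.mul hb
  have t3 : (fun τ => 2 * ((thetaV τ - PV τ) * (thetaV τ + PV τ))) =O[atImInfty] fun τ => expDecayHalf τ ^ 4 := by
    have hb : (fun τ => thetaV τ + PV τ) =O[atImInfty] fun _ : ℍ => (1 : ℝ) := hV1.add hPV1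
    have hV' : (fun τ => thetaV τ - PV τ) =O[atImInfty] fun τ => expDecayHalf τ ^ 4 :=
      hV.congr_left fun τ => by simp only [hPV]; ring
    simpa using (hV'.mul hb).const_mul_left 2
  have t4 : (fun τ => qhalf τ ^ 4 * (1920 + 6144 * qhalf τ ^ 2)) =O[atImInfty] fun τ => expDecayHalf τ ^ 4 := by
    have h4 : (fun τ => qhalf τ ^ 4) =O[atImInfty] fun τ => expDecayHalf τ ^ 4 := by simpa using hq.pow 4
    have hb : (fun τ => 1920 + 6144 * qhalf τ ^ 2) =O[atImInfty] fun _ : ℍ => (1 : ℝ) :=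
      (hPb 1920 0 6144 0).congr_left fun τ => by ring
    simpa using h4.mul hb
  exact (((t1.add t2).add t3).add t4).congr' (Eventually.of_forall fun τ => by beta_reduce; rw [hform τ]) EventuallyEq.rfl

/-- **`ξ₂|S − ξ₄|S + 72b + 168q = O(e^{−3πy})`** (`−U − V − U² − V² + 2W²`; polynomial remainder
`−1440b³ − 960b⁴ − 4608b⁵ − 3072b⁶`). [cite: CohnEtAl2019, §4.4 (4.14)] -/
theorem xi2S_sub_xi4S_third_order :
    (fun τ => xi2S τ - xi4S τ + 72 * qhalf τ + 168 * qhalf τ ^ 2) =O[atImInfty] fun τ => expDecayHalf τ ^ 3 := by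
  obtain ⟨hU1, hV1, hW1⟩ := thetaUVW_isBigO_one
  have hA := thetaU_fourth_order.trans (expDecayHalf_pow_isBigO_pow (m := 4) (n := 3) (by norm_num))
  have hB := thetaW_fourth_order.trans (expDecayHalf_pow_isBigO_pow (m := 4) (n := 3) (by norm_num))
  have hV := thetaV_fourth_order.trans (expDecayHalf_pow_isBigO_pow (m := 5) (n := 3) (by norm_num))
  have hq := qhalf_isBigO
  have hq1 := qhalf_isBigO_one
  set PU : ℍ → ℂ := fun τ => 1 + 8 * qhalf τ + 24 * qhalf τ ^ 2 + 32 * qhalf τ ^ 3 with hPU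
  set PW : ℍ → ℂ := fun τ => 1 - 8 * qhalf τ + 24 * qhalf τ ^ 2 - 32 * qhalf τ ^ 3 with hPW
  set PV : ℍ → ℂ := fun τ => 16 * qhalf τ + 64 * qhalf τ ^ 3 with hPV
  have hform : ∀ τ : ℍ, xi2S τ - xi4S τ + 72 * qhalf τ + 168 * qhalf τ ^ 2 =
      -((thetaU τ - PU τ) * (1 + thetaU τ + PU τ)) - (thetaV τ - PV τ) * (1 + thetaV τ + PV τ)
      + 2 * ((thetaW τ - PW τ) * (thetaW τ + PW τ))
      + qhalf τ ^ 3 * (-1440 - 960 * qhalf τ - 4608 * qhalf τ ^ 2 - 3072 * qhalf τ ^ 3) := by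
    intro τ
    simp only [xi2S, xi4S, hPU, hPW, hPV, Pi.add_apply, Pi.sub_apply, Pi.mul_apply, Pi.neg_apply, Pi.smul_apply, smul_eq_mul]
    ring
  have hPb : ∀ (c₀ c₁ c₂ c₃ : ℂ), (fun τ => c₀ + c₁ * qhalf τ + c₂ * qhalf τ ^ 2 + c₃ * qhalf τ ^ 3) =O[atImInfty]
      fun _ : ℍ => (1 : ℝ) := by
    intro c₀ c₁ c₂ c₃
    have p2 : (fun τ => qhalf τ ^ 2) =O[atImInfty] fun _ : ℍ => (1 : ℝ) := by simpa [sq] using isBigO_mul_of_isBigO_one hq1 hq1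
    have p3 : (fun τ => qhalf τ ^ 3) =O[atImInfty] fun _ : ℍ => (1 : ℝ) := by
      simpa [pow_succ] using isBigO_mul_of_isBigO_one (isBigO_mul_of_isBigO_one hq1 hq1) hq1
    by_cases h0 : c₀ = 0
    · subst h0
      have := ((hq1.const_mul_left c₁).add (p2.const_mul_left c₂)).add (p3.const_mul_left c₃)
      exact this.congr_left fun τ => by ring
    · exact (((isBigO_const_const c₀ one_ne_zero _).add (hq1.const_mul_left c₁)).add (p2.const_mul_left c₂)).add
        (p3.const_mul_left c₃)
  have hPU1 : PU =O[atImInfty] fun _ : ℍ => (1 : ℝ) := hPb 1 8 24 32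
  have hPW1 : PW =O[atImInfty] fun _ : ℍ => (1 : ℝ) := (hPb 1 (-8) 24 (-32)).congr_left fun τ => by simp only [hPW]; ring
  have hPV1 : PV =O[atImInfty] fun _ : ℍ => (1 : ℝ) := (hPb 0 16 0 64).congr_left fun τ => by simp only [hPV]; ring
  have t1 : (fun τ => (thetaU τ - PU τ) * (1 + thetaU τ + PU τ)) =O[atImInfty] fun τ => expDecayHalf τ ^ 3 := by
    have hb : (fun τ => 1 + thetaU τ + PU τ) =O[atImInfty] fun _ : ℍ => (1 : ℝ) :=
      ((isBigO_const_const (1 : ℂ) one_ne_zero _).add hU1).add hPU1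
    have hA' : (fun τ => thetaU τ - PU τ) =O[atImInfty] fun τ => expDecayHalf τ ^ 3 :=
      hA.congr_left fun τ => by simp only [hPU]; ring
    simpa using hA'.mul hb
  have t2 : (fun τ => (thetaV τ - PV τ) * (1 + thetaV τ + PV τ)) =O[atImInfty] fun τ => expDecayHalf τ ^ 3 := by
    have hb : (fun τ => 1 + thetaV τ + PV τ) =O[atImInfty] fun _ : ℍ => (1 : ℝ) :=
      ((isBigO_const_const (1 : ℂ) one_ne_zero _).add hV1).add hPV1
    have hV' : (fun τ => thetaV τ - PV τ) =O[atImInfty] fun τ => expDecayHalf τ ^ 3 :=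
      hV.congr_left fun τ => by simp only [hPV]; ring
    simpa using hV'.mul hb
  have t3 : (fun τ => 2 * ((thetaW τ - PW τ) * (thetaW τ + PW τ))) =O[atImInfty] fun τ => expDecayHalf τ ^ 3 := by
    have hb : (fun τ => thetaW τ + PW τ) =O[atImInfty] fun _ : ℍ => (1 : ℝ) := hW1.add hPW1
    have hB' : (fun τ => thetaW τ - PW τ) =O[atImInfty] fun τ => expDecayHalf τ ^ 3 :=
      hB.congr_left fun τ => by simp only [hPW]; ring
    simpa using (hB'.mul hb).const_mul_left 2
  have t4 : (fun τ => qhalf τ ^ 3 * (-1440 - 960 * qhalf τ - 4608 * qhalf τ ^ 2 - 3072 * qhalf τ ^ 3)) =O[atImInfty]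
      fun τ => expDecayHalf τ ^ 3 := by
    have h3 : (fun τ => qhalf τ ^ 3) =O[atImInfty] fun τ => expDecayHalf τ ^ 3 := by simpa using hq.pow 3
    have hb : (fun τ => -1440 - 960 * qhalf τ - 4608 * qhalf τ ^ 2 - 3072 * qhalf τ ^ 3) =O[atImInfty] fun _ : ℍ => (1 : ℝ) :=
      (hPb (-1440) (-960) (-4608) (-3072)).congr_left fun τ => by ring
    simpa using h3.mul hb
  exact (((t1.neg_left.sub t2).add t3).add t4).congr' (Eventually.of_forall fun τ => by beta_reduce; rw [hform τ])
    EventuallyEq.rfl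

/-! ## `ψ₂ − ψ₄` and `ψ₄` to the needed orders -/

/-- `Λ(τ) = πiτ + log 16`, the non-decaying part of `𝓛`. [cite: CohnEtAl2019, §2.1.2 (2.10)] -/
def lamLead (τ : ℍ) : ℂ := π * I * τ + (Real.log 16 : ℝ)

/-- `Λ = O(|τ|)`. [folklore] -/
theorem lamLead_isBigO : lamLead =O[atImInfty] fun τ : ℍ => ‖(τ : ℂ)‖ := by
  have h1 : (fun τ : ℍ => (π * I * τ : ℂ)) =O[atImInfty] fun τ : ℍ => ‖(τ : ℂ)‖ :=
    IsBigO.of_bound π (Eventually.of_forall fun τ => by simp [abs_of_pos Real.pi_pos])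
  have h2 : (fun _ : ℍ => ((Real.log 16 : ℝ) : ℂ)) =O[atImInfty] fun τ : ℍ => ‖(τ : ℂ)‖ :=
    isBigO_norm_coe_of_bounded (Filter.const_boundedAtFilter _ _)
  exact (h1.add h2).congr_left fun τ => by simp [lamLead]

/-- `𝓛 − Λ + 8b = O(e^{−2πy})` (restating `logLambda_second_order`). [cite: CohnEtAl2019, §2.1.2 (2.10)] -/
theorem logLambda_sub_lamLead_isBigO :
    (fun τ => logLambda τ - lamLead τ + 8 * qhalf τ) =O[atImInfty] fun τ => expDecayHalf τ ^ 2 :=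
  logLambda_second_order.congr_left fun τ => by simp only [lamLead]; ring

/-- **`ψ₂ − ψ₄ − (336Λ + 1152)q = O(|τ|e^{−4πy})`**: with `b = q^{1/2}`,
`ψ₂ − ψ₄ − (336Λ + 1152)b² = (ξ₂−ξ₄−336b²)𝓛 + 336b²(𝓛 − Λ + 8b) + (ξ₂|S−ξ₄|S+72b+168b²)𝓛_S`
`  − 72b(𝓛_S + 16b) − 168b²(𝓛_S + 16b)` (the `b³`-terms `−2688b³ + 1152·… + 2688b³` cancel).
[cite: CohnEtAl2019, §4.4 (4.14)] -/
theorem psi2_sub_psi4_second_order :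
    (fun τ => psi2 τ - psi4 τ - (336 * lamLead τ + 1152) * qhalf τ ^ 2) =O[atImInfty]
      fun τ : ℍ => ‖(τ : ℂ)‖ * expDecayHalf τ ^ 4 := by
  have h1 := xi2_sub_xi4_fourth_order
  have h2 := logLambda_sub_lamLead_isBigO
  have h3 := xi2S_sub_xi4S_third_order
  have h4 := logLambdaS_third_order
  have hL := logLambda_isBigO
  have hLS := logLambdaS_isBigO
  have hq := qhalf_isBigO
  have one_le : ∀ᶠ τ : ℍ in atImInfty, 1 ≤ ‖(τ : ℂ)‖ := eventually_one_le_norm_coe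
  -- helper: `O(b⁴) ⊂ O(|τ| b⁴)`
  have up : ∀ {f : ℍ → ℂ}, f =O[atImInfty] (fun τ => expDecayHalf τ ^ 4) →
      f =O[atImInfty] fun τ : ℍ => ‖(τ : ℂ)‖ * expDecayHalf τ ^ 4 := by
    intro f hf
    refine hf.trans (IsBigO.of_bound 1 ?_)
    filter_upwards [one_le] with τ hτ
    rw [Real.norm_of_nonneg (pow_nonneg (expDecayHalf_pos τ).le _),
      Real.norm_of_nonneg (mul_nonneg (norm_nonneg _) (pow_nonneg (expDecayHalf_pos τ).le _)), one_mul]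
    nlinarith [pow_pos (expDecayHalf_pos τ) 4]
  have t1 : (fun τ => (xi2 τ - xi4 τ - 336 * qhalf τ ^ 2) * logLambda τ) =O[atImInfty]
      fun τ : ℍ => ‖(τ : ℂ)‖ * expDecayHalf τ ^ 4 := (h1.mul hL).congr_right fun τ => by ring
  have t2 : (fun τ => 336 * qhalf τ ^ 2 * (logLambda τ - lamLead τ + 8 * qhalf τ)) =O[atImInfty]
      fun τ : ℍ => ‖(τ : ℂ)‖ * expDecayHalf τ ^ 4 := by
    have hqq : (fun τ => qhalf τ ^ 2) =O[atImInfty] fun τ => expDecayHalf τ ^ 2 := by simpa using hq.pow 2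
    have := (hqq.mul h2).const_mul_left 336
    exact up ((this.congr_left fun τ => by ring).congr_right fun τ => by ring)
  have t3 : (fun τ => (xi2S τ - xi4S τ + 72 * qhalf τ + 168 * qhalf τ ^ 2) * logLambdaS τ) =O[atImInfty]
      fun τ : ℍ => ‖(τ : ℂ)‖ * expDecayHalf τ ^ 4 :=
    up ((h3.mul hLS).congr_right fun τ => by ring)
  have t4 : (fun τ => 72 * qhalf τ * (logLambdaS τ + 16 * qhalf τ)) =O[atImInfty]
      fun τ : ℍ => ‖(τ : ℂ)‖ * expDecayHalf τ ^ 4 := by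
    have := (hq.mul h4).const_mul_left 72
    exact up ((this.congr_left fun τ => by ring).congr_right fun τ => by ring)
  have t5 : (fun τ => 168 * qhalf τ ^ 2 * (logLambdaS τ + 16 * qhalf τ)) =O[atImInfty]
      fun τ : ℍ => ‖(τ : ℂ)‖ * expDecayHalf τ ^ 4 := by
    have hqq : (fun τ => qhalf τ ^ 2) =O[atImInfty] fun τ => expDecayHalf τ ^ 2 := by simpa using hq.pow 2
    have h5 : (fun τ => qhalf τ ^ 2 * (logLambdaS τ + 16 * qhalf τ)) =O[atImInfty] fun τ => expDecayHalf τ ^ 5 :=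
      (hqq.mul h4).congr_right fun τ => by ring
    have h6 := (h5.trans (expDecayHalf_pow_isBigO_pow (m := 5) (n := 4) (by norm_num))).const_mul_left (168 : ℂ)
    exact up (h6.congr_left fun τ => by ring)
  exact ((((t1.add t2).add t3).sub t4).sub t5).congr_left fun τ => by
    simp only [psi2, psi4, Pi.add_apply, Pi.mul_apply]; ring

/-- `ξ₄ − 2 = O(e^{−2πy})` and `ξ₄|S + 1 = O(e^{−πy})`. [cite: CohnEtAl2019, §2.1.2 (2.8)] -/
theorem xi4_sub_two_isBigO :
    ((fun τ => xi4 τ - 2) =O[atImInfty] fun τ => expDecayHalf τ ^ 2) ∧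
    ((fun τ => xi4S τ + 1) =O[atImInfty] fun τ => expDecayHalf τ) := by
  obtain ⟨hU1, hV1, hW1⟩ := thetaUVW_isBigO_one
  have hU := thetaU_second_order
  have hW := thetaW_second_order
  have hu := thetaU_sub_one_isBigO
  have hw := thetaW_sub_one_isBigO
  have hv := thetaV_isBigO
  have hq := qhalf_isBigO
  have hq1 := qhalf_isBigO_one
  refine ⟨?_, ?_⟩
  · -- `ξ₄ − 2 = (U−1−8b)(U+1) + (W−1+8b)(W+1) + 8b((U−1) − (W−1)) − 2V²`
    have hform : ∀ τ : ℍ, xi4 τ - 2 = (thetaU τ - 1 - 8 * qhalf τ) * (thetaU τ + 1) + (thetaW τ - 1 + 8 * qhalf τ) * (thetaW τ + 1)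
        + 8 * qhalf τ * ((thetaU τ - 1) - (thetaW τ - 1)) - 2 * (thetaV τ * thetaV τ) := by
      intro τ
      simp only [xi4, Pi.add_apply, Pi.sub_apply, Pi.mul_apply, Pi.smul_apply, smul_eq_mul]; ring
    have t1 : (fun τ => (thetaU τ - 1 - 8 * qhalf τ) * (thetaU τ + 1)) =O[atImInfty] fun τ => expDecayHalf τ ^ 2 := by
      simpa using hU.mul (hU1.add (isBigO_const_const (1 : ℂ) one_ne_zero _))
    have t2 : (fun τ => (thetaW τ - 1 + 8 * qhalf τ) * (thetaW τ + 1)) =O[atImInfty] fun τ => expDecayHalf τ ^ 2 := by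
      simpa using hW.mul (hW1.add (isBigO_const_const (1 : ℂ) one_ne_zero _))
    have t3 : (fun τ => 8 * qhalf τ * ((thetaU τ - 1) - (thetaW τ - 1))) =O[atImInfty] fun τ => expDecayHalf τ ^ 2 := by
      have := (hq.mul (hu.sub hw)).const_mul_left 8
      exact (this.congr_left fun τ => by ring).congr_right fun τ => by ring
    have t4 : (fun τ => 2 * (thetaV τ * thetaV τ)) =O[atImInfty] fun τ => expDecayHalf τ ^ 2 := by
      simpa [sq] using (hv.mul hv).const_mul_left 2
    exact (((t1.add t2).add t3).sub t4).congr' (Eventually.of_forall fun τ => by beta_reduce; rw [hform τ]) EventuallyEq.rfl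
  · -- `ξ₄|S + 1 = (U−1)(U+1) + V² − 2(W−1)(W+1)`
    have hform : ∀ τ : ℍ, xi4S τ + 1 = (thetaU τ - 1) * (thetaU τ + 1) + thetaV τ * thetaV τ - 2 * ((thetaW τ - 1) * (thetaW τ + 1)) := by
      intro τ
      simp only [xi4S, Pi.add_apply, Pi.sub_apply, Pi.mul_apply, Pi.smul_apply, smul_eq_mul]; ring
    have t1 : (fun τ => (thetaU τ - 1) * (thetaU τ + 1)) =O[atImInfty] fun τ => expDecayHalf τ := by
      simpa using hu.mul (hU1.add (isBigO_const_const (1 : ℂ) one_ne_zero _))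
    have t2 : (fun τ => thetaV τ * thetaV τ) =O[atImInfty] fun τ => expDecayHalf τ := by simpa using hv.mul hV1
    have t3 : (fun τ => 2 * ((thetaW τ - 1) * (thetaW τ + 1))) =O[atImInfty] fun τ => expDecayHalf τ := by
      simpa using (hw.mul (hW1.add (isBigO_const_const (1 : ℂ) one_ne_zero _))).const_mul_left 2
    exact ((t1.add t2).sub t3).congr' (Eventually.of_forall fun τ => by beta_reduce; rw [hform τ]) EventuallyEq.rfl

/-- **`ψ₄ − 2Λ = O(|τ|e^{−2πy})`**: `ψ₄ − 2Λ = (ξ₄ − 2)𝓛 + 2(𝓛 − Λ + 8b) + (ξ₄|S + 1)𝓛_S − (𝓛_S + 16b)`.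
[cite: CohnEtAl2019, §4.4 (4.14)] -/
theorem psi4_sub_two_lamLead_isBigO :
    (fun τ => psi4 τ - 2 * lamLead τ) =O[atImInfty] fun τ : ℍ => ‖(τ : ℂ)‖ * expDecayHalf τ ^ 2 := by
  obtain ⟨hx4, hx4S⟩ := xi4_sub_two_isBigO
  have h2 := logLambda_sub_lamLead_isBigO
  have h4 := logLambdaS_second_order
  have hL := logLambda_isBigO
  have hLS := logLambdaS_isBigO
  have one_le : ∀ᶠ τ : ℍ in atImInfty, 1 ≤ ‖(τ : ℂ)‖ := eventually_one_le_norm_coe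
  have up : ∀ {f : ℍ → ℂ}, f =O[atImInfty] (fun τ => expDecayHalf τ ^ 2) →
      f =O[atImInfty] fun τ : ℍ => ‖(τ : ℂ)‖ * expDecayHalf τ ^ 2 := by
    intro f hf
    refine hf.trans (IsBigO.of_bound 1 ?_)
    filter_upwards [one_le] with τ hτ
    rw [Real.norm_of_nonneg (pow_nonneg (expDecayHalf_pos τ).le _),
      Real.norm_of_nonneg (mul_nonneg (norm_nonneg _) (pow_nonneg (expDecayHalf_pos τ).le _)), one_mul]
    nlinarith [pow_pos (expDecayHalf_pos τ) 2]
  have t1 : (fun τ => (xi4 τ - 2) * logLambda τ) =O[atImInfty] fun τ : ℍ => ‖(τ : ℂ)‖ * expDecayHalf τ ^ 2 :=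
    (hx4.mul hL).congr_right fun τ => by ring
  have t2 : (fun τ => 2 * (logLambda τ - lamLead τ + 8 * qhalf τ)) =O[atImInfty] fun τ : ℍ => ‖(τ : ℂ)‖ * expDecayHalf τ ^ 2 :=
    up (h2.const_mul_left 2)
  have t3 : (fun τ => (xi4S τ + 1) * logLambdaS τ) =O[atImInfty] fun τ : ℍ => ‖(τ : ℂ)‖ * expDecayHalf τ ^ 2 :=
    up ((hx4S.mul hLS).congr_right fun τ => by ring)
  have t4 : (fun τ => logLambdaS τ + 16 * qhalf τ) =O[atImInfty] fun τ : ℍ => ‖(τ : ℂ)‖ * expDecayHalf τ ^ 2 := up h4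
  exact (((t1.add t2).add t3).sub t4).congr_left fun τ => by
    simp only [psi4, Pi.add_apply, Pi.mul_apply]; ring

/-- `ψ₂ = O(|τ|)` (from `ψ₄ = O(|τ|)` and `ψ₂ − ψ₄ = O(|τ|q)`). [cite: CohnEtAl2019, §4.2] -/
theorem psi2_isBigO : psi2 =O[atImInfty] fun τ : ℍ => ‖(τ : ℂ)‖ := by
  have h0 : (fun τ : ℍ => ‖(τ : ℂ)‖ * expDecay τ) =O[atImInfty] fun τ : ℍ => ‖(τ : ℂ)‖ :=
    IsBigO.of_bound 1 (Eventually.of_forall fun τ => by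
      rw [Real.norm_of_nonneg (mul_nonneg (norm_nonneg _) (expDecay_pos τ).le), norm_norm, one_mul]
      exact mul_le_of_le_one_right (norm_nonneg _) (expDecay_le_one τ))
  have h : (fun τ => psi2 τ - psi4 τ) =O[atImInfty] fun τ : ℍ => ‖(τ : ℂ)‖ := psi2_sub_psi4_isBigO.trans h0
  exact (h.add psi4_isBigO).congr_left fun τ => by ring

/-! ## `E₁₀ − E₈` -/

/-- **`E₁₀ − E₈ + 744q = O(q²)`**, `E₁₀ − E₈ = O(q)`, `E₈ − 1 = O(q)`. [cite: CohnEtAl2019, §2.1.1 (2.1)] -/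
theorem E10_sub_E8_second_order :
    ((fun τ => E10fun τ - E8fun τ + 744 * qfun τ) =O[atImInfty] fun τ => expDecay τ ^ 2) ∧
    ((fun τ => E10fun τ - E8fun τ) =O[atImInfty] fun τ => expDecay τ) ∧
    ((fun τ => E8fun τ - 1) =O[atImInfty] fun τ => expDecay τ) := by
  have hX := E₄_sub_one_isBigO
  have hY := E₆_sub_one_isBigO
  have hX2 := E₄_second_order
  have hY2 := E₆_second_order
  have hq := qfun_isBigO
  have hE4b : (⇑E₄ : ℍ → ℂ) =O[atImInfty] fun _ : ℍ => (1 : ℝ) := ModularFormClass.bdd_at_infty E₄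
  have hX1 : (fun τ : ℍ => E₄ τ - 1) =O[atImInfty] fun _ : ℍ => (1 : ℝ) := hX.trans expDecay_isBigO_one'
  refine ⟨?_, ?_, ?_⟩
  · -- `E₄(E₆ − E₄) + 744q = E₄[(E₆−1+504q) − (E₄−1−240q)] − 744q(E₄ − 1)`
    have t1 : (fun τ => E₄ τ * ((E₆ τ - 1 + 504 * qfun τ) - (E₄ τ - 1 - 240 * qfun τ))) =O[atImInfty]
        fun τ => expDecay τ ^ 2 := by simpa using hE4b.mul (hY2.sub hX2)
    have t2 : (fun τ => 744 * qfun τ * (E₄ τ - 1)) =O[atImInfty] fun τ => expDecay τ ^ 2 := by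
      have := (hq.mul hX).const_mul_left 744
      exact (this.congr_left fun τ => by ring).congr_right fun τ => by ring
    exact (t1.sub t2).congr_left fun τ => by simp only [E10fun, E8fun, Pi.mul_apply]; ring
  · have : (fun τ => E₄ τ * ((E₆ τ - 1) - (E₄ τ - 1))) =O[atImInfty] fun τ => expDecay τ := by
      simpa using hE4b.mul (hY.sub hX)
    exact this.congr_left fun τ => by simp only [E10fun, E8fun, Pi.mul_apply]; ring
  · have : (fun τ => (E₄ τ - 1) * (E₄ τ + 1)) =O[atImInfty] fun τ => expDecay τ := by
      simpa using hX.mul (hE4b.add (isBigO_const_const (1 : ℂ) one_ne_zero _))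
    exact this.congr_left fun τ => by simp only [E8fun, Pi.mul_apply]; ring

/-! ## The two cancelling combinations `D₁`, `D₂` -/

/-- `O(|τ|e^{−4πy})` class helpers. [folklore] -/
theorem isBigO_up4 {f : ℍ → ℂ} (hf : f =O[atImInfty] fun τ => expDecay τ ^ 2) :
    f =O[atImInfty] fun τ : ℍ => ‖(τ : ℂ)‖ * expDecay τ ^ 2 := by
  refine hf.trans (IsBigO.of_bound 1 ?_)
  filter_upwards [eventually_one_le_norm_coe] with τ hτ
  rw [Real.norm_of_nonneg (sq_nonneg _), Real.norm_of_nonneg (mul_nonneg (norm_nonneg _) (sq_nonneg _)), one_mul]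
  nlinarith [sq_nonneg (expDecay τ)]

/-- **`D₁ = ψ₂E₁₀ − ψ₄E₈ = (1152 − 1152Λ)q + O(|τ|q²)`.** [cite: CohnEtAl2019, §4.4 (4.14)] -/
theorem D1_second_order :
    (fun τ => psi2 τ * E10fun τ - psi4 τ * E8fun τ - (1152 - 1152 * lamLead τ) * qfun τ) =O[atImInfty]
      fun τ : ℍ => ‖(τ : ℂ)‖ * expDecay τ ^ 2 := by
  obtain ⟨h744, hE108, hE8⟩ := E10_sub_E8_second_order
  have hd := psi2_sub_psi4_second_order
  have hp4 := psi4_sub_two_lamLead_isBigO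
  have hΛ := lamLead_isBigO
  have hq := qfun_isBigO
  have hE10b : E10fun =O[atImInfty] fun _ : ℍ => (1 : ℝ) := by
    have h : E10fun =O[atImInfty] fun _ : ℍ => (1 : ℝ) :=
      (ModularFormClass.bdd_at_infty E₄).mul (ModularFormClass.bdd_at_infty E₆) |>.congr_left fun τ => rfl
    exact h
  have hE10q : (fun τ => E10fun τ - 1) =O[atImInfty] fun τ => expDecay τ := by
    have := hE108.add hE8
    exact this.congr_left fun τ => by ring
  -- `D₁ − (1152 − 1152Λ)q = (ψ₂−ψ₄−(336Λ+1152)q)E₁₀ + (336Λ+1152)q(E₁₀ − 1) + (ψ₄ − 2Λ)(E₁₀ − E₈) + 2Λ(E₁₀ − E₈ + 744q)`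
  have t1 : (fun τ => (psi2 τ - psi4 τ - (336 * lamLead τ + 1152) * qhalf τ ^ 2) * E10fun τ) =O[atImInfty]
      fun τ : ℍ => ‖(τ : ℂ)‖ * expDecay τ ^ 2 := by
    have := hd.mul hE10b
    refine this.congr_right fun τ => ?_
    rw [expDecayHalf_pow_four]; ring
  have t2 : (fun τ => (336 * lamLead τ + 1152) * qfun τ * (E10fun τ - 1)) =O[atImInfty]
      fun τ : ℍ => ‖(τ : ℂ)‖ * expDecay τ ^ 2 := by
    have hc : (fun τ => 336 * lamLead τ + 1152) =O[atImInfty] fun τ : ℍ => ‖(τ : ℂ)‖ :=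
      (hΛ.const_mul_left 336).add (isBigO_norm_coe_of_bounded (Filter.const_boundedAtFilter _ _))
    have := hc.mul (hq.mul hE10q)
    exact (this.congr_left fun τ => by ring).congr_right fun τ => by ring
  have t3 : (fun τ => (psi4 τ - 2 * lamLead τ) * (E10fun τ - E8fun τ)) =O[atImInfty]
      fun τ : ℍ => ‖(τ : ℂ)‖ * expDecay τ ^ 2 := by
    have := hp4.mul hE108
    exact this.congr_right fun τ => by rw [expDecayHalf_sq']; ring
  have t4 : (fun τ => 2 * lamLead τ * (E10fun τ - E8fun τ + 744 * qfun τ)) =O[atImInfty]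
      fun τ : ℍ => ‖(τ : ℂ)‖ * expDecay τ ^ 2 := by
    have := (hΛ.mul h744).const_mul_left 2
    exact this.congr_left fun τ => by ring
  exact (((t1.add t2).add t3).add t4).congr_left fun τ => by rw [qhalf_sq]; ring

/-- **`D₂ = ψ₄E₈J⁻¹ − 2Δ = (2Λ − 2)q + O(|τ|q²)`.** [cite: CohnEtAl2019, §4.4 (4.14)] -/
theorem D2_second_order (z : ℍ) :
    (fun τ => psi4 τ * E8fun τ * (kleinJ τ - kleinJ z)⁻¹ - 2 * ModularForm.discriminant τ - (2 * lamLead τ - 2) * qfun τ)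
      =O[atImInfty] fun τ : ℍ => ‖(τ : ℂ)‖ * expDecay τ ^ 2 := by
  obtain ⟨_, _, hE8⟩ := E10_sub_E8_second_order
  have hp4 := psi4_sub_two_lamLead_isBigO
  have hΛ := lamLead_isBigO
  have hJ := inv_kleinJ_sub_isBigO z
  have hJq := inv_kleinJ_sub_sub_q_isBigO z
  have hΔq := discriminant_second_order
  have hE8b : E8fun =O[atImInfty] fun _ : ℍ => (1 : ℝ) := by
    have h : E8fun =O[atImInfty] fun _ : ℍ => (1 : ℝ) :=
      (ModularFormClass.bdd_at_infty E₄).mul (ModularFormClass.bdd_at_infty E₄) |>.congr_left fun τ => rfl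
    exact h
  -- `D₂ − (2Λ−2)q = (ψ₄ − 2Λ)E₈J⁻¹ + 2Λ(E₈ − 1)J⁻¹ + 2Λ(J⁻¹ − q) − 2(Δ − q)`
  have t1 : (fun τ => (psi4 τ - 2 * lamLead τ) * (E8fun τ * (kleinJ τ - kleinJ z)⁻¹)) =O[atImInfty]
      fun τ : ℍ => ‖(τ : ℂ)‖ * expDecay τ ^ 2 := by
    have := hp4.mul (isBigO_mul_of_isBigO_one hE8b hJ)
    exact this.congr_right fun τ => by rw [expDecayHalf_sq']; ring
  have t2 : (fun τ => 2 * lamLead τ * ((E8fun τ - 1) * (kleinJ τ - kleinJ z)⁻¹)) =O[atImInfty]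
      fun τ : ℍ => ‖(τ : ℂ)‖ * expDecay τ ^ 2 := by
    have := (hΛ.mul (hE8.mul hJ)).const_mul_left 2
    exact (this.congr_left fun τ => by ring).congr_right fun τ => by ring
  have t3 : (fun τ => 2 * lamLead τ * ((kleinJ τ - kleinJ z)⁻¹ - qfun τ)) =O[atImInfty]
      fun τ : ℍ => ‖(τ : ℂ)‖ * expDecay τ ^ 2 := by
    have := (hΛ.mul hJq).const_mul_left 2
    exact this.congr_left fun τ => by ring
  have t4 : (fun τ => 2 * (ModularForm.discriminant τ - qfun τ)) =O[atImInfty] fun τ : ℍ => ‖(τ : ℂ)‖ * expDecay τ ^ 2 :=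
    isBigO_up4 (hΔq.const_mul_left 2)
  exact (((t1.add t2).add t3).sub t4).congr_left fun τ => by ring

/-! ## The bound -/

/-- **(4.14) for `𝒦₋^{(24)}`**: for fixed `z`, `𝒦₋^{(24)}(τ, z) = O(|τ| e^{−4π Im τ})` as `Im τ → ∞`.
[cite: CohnEtAl2019, §4.4 (4.14)] -/
theorem kernelMinus24_isBigO (z : ℍ) :
    (fun τ => kernelMinus24 τ z) =O[atImInfty] fun τ : ℍ => ‖(τ : ℂ)‖ * expDecay τ ^ 2 := by
  obtain ⟨_, hE108, _⟩ := E10_sub_E8_second_order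
  have hD1 := D1_second_order
  have hD2 := D2_second_order z
  have hΛ := lamLead_isBigO
  have hJ := inv_kleinJ_sub_isBigO z
  have hΔ := discriminant_isBigO
  have hq := qfun_isBigO
  have hp2 := psi2_isBigO
  have hp4 := psi4_isBigO
  have hdiff := psi2_sub_psi4_isBigO
  have hE8b : E8fun =O[atImInfty] fun _ : ℍ => (1 : ℝ) := by
    have h : E8fun =O[atImInfty] fun _ : ℍ => (1 : ℝ) :=
      (ModularFormClass.bdd_at_infty E₄).mul (ModularFormClass.bdd_at_infty E₄) |>.congr_left fun τ => rfl
    exact h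
  -- `D₁ = O(|τ| q)`
  have hD1' : (fun τ => psi2 τ * E10fun τ - psi4 τ * E8fun τ) =O[atImInfty] fun τ : ℍ => ‖(τ : ℂ)‖ * expDecay τ := by
    have h0 : (fun τ : ℍ => ‖(τ : ℂ)‖ * expDecay τ ^ 2) =O[atImInfty] fun τ : ℍ => ‖(τ : ℂ)‖ * expDecay τ :=
      IsBigO.of_bound 1 (Eventually.of_forall fun τ => by
        rw [Real.norm_of_nonneg (mul_nonneg (norm_nonneg _) (sq_nonneg _)),
          Real.norm_of_nonneg (mul_nonneg (norm_nonneg _) (expDecay_pos τ).le), one_mul, sq]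
        exact mul_le_mul_of_nonneg_left (mul_le_of_le_one_left (expDecay_pos τ).le (expDecay_le_one τ)) (norm_nonneg _))
    have h1 : (fun τ => psi2 τ * E10fun τ - psi4 τ * E8fun τ - (1152 - 1152 * lamLead τ) * qfun τ) =O[atImInfty]
        fun τ : ℍ => ‖(τ : ℂ)‖ * expDecay τ := hD1.trans h0
    have h2 : (fun τ => (1152 - 1152 * lamLead τ) * qfun τ) =O[atImInfty] fun τ : ℍ => ‖(τ : ℂ)‖ * expDecay τ := by
      have hc : (fun τ => 1152 - 1152 * lamLead τ) =O[atImInfty] fun τ : ℍ => ‖(τ : ℂ)‖ :=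
        (isBigO_norm_coe_of_bounded (Filter.const_boundedAtFilter _ (1152 : ℂ))).sub (hΛ.const_mul_left 1152)
      exact hc.mul hq
    exact (h1.add h2).congr_left fun τ => by ring
  -- 𝒜 − its vanishing `q`-part: `𝒜 = 3(D₁ − c₁q) + 𝔠(D₂ − c₂q) + j(z)J⁻¹D₁` since `3c₁ + 𝔠c₂ = 0`
  have hA : (fun τ => 3 * (psi2 τ * E10fun τ - psi4 τ * E8fun τ) + kleinJ z * (kleinJ τ - kleinJ z)⁻¹ * (psi2 τ * E10fun τ - psi4 τ * E8fun τ)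
      + 1728 * (psi4 τ * E8fun τ * (kleinJ τ - kleinJ z)⁻¹ - 2 * ModularForm.discriminant τ)) =O[atImInfty]
      fun τ : ℍ => ‖(τ : ℂ)‖ * expDecay τ ^ 2 := by
    have g1 := hD1.const_mul_left 3
    have g2 := hD2.const_mul_left 1728
    have g3 : (fun τ => kleinJ z * (kleinJ τ - kleinJ z)⁻¹ * (psi2 τ * E10fun τ - psi4 τ * E8fun τ)) =O[atImInfty]
        fun τ : ℍ => ‖(τ : ℂ)‖ * expDecay τ ^ 2 := by
      have := (hJ.mul hD1').const_mul_left (kleinJ z)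
      exact (this.congr_left fun τ => by ring).congr_right fun τ => by ring
    exact ((g1.add g3).add g2).congr_left fun τ => by ring
  -- 𝓑 = (ψ₄E₈ − ψ₂E₁₀)J⁻¹
  have hB : (fun τ => (psi4 τ * E8fun τ - psi2 τ * E10fun τ) * (kleinJ τ - kleinJ z)⁻¹) =O[atImInfty]
      fun τ : ℍ => ‖(τ : ℂ)‖ * expDecay τ ^ 2 := by
    have := (hD1'.mul hJ).neg_left
    exact (this.congr_left fun τ => by ring).congr_right fun τ => by ring
  -- 𝒟 = ΔJ⁻¹
  have hD : (fun τ => ModularForm.discriminant τ * (kleinJ τ - kleinJ z)⁻¹) =O[atImInfty]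
      fun τ : ℍ => ‖(τ : ℂ)‖ * expDecay τ ^ 2 := isBigO_up4 (by simpa [sq] using hΔ.mul hJ)
  set c : ℂ := 1 / (2 * 1728 * (π : ℂ)) with hc
  have total := (((hA.const_mul_left (psiTilde2 z)).add (hB.const_mul_left (fNeg2fun z * psiTilde4 z))).sub
    (hD.const_mul_left (2 * 1728 * (f2fun z * psiTilde0 z)))).const_mul_left (c / ModularForm.discriminant z)
  refine total.congr' ?_ EventuallyEq.rfl
  filter_upwards [eventually_kleinJ_ne z] with τ hJne
  have hΔz := ModularForm.discriminant_ne_zero z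
  simp only [kernelMinus24, hc]
  field_simp
  ring

end Literature.NumberTheory.ModularForms
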